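import Summits.BirchSwinnertonDyer.BirchSwinnertonDyer.Theorems.SchneiderFreeAdditiveX3PotMultReadHypsOriented
import HarnessLib
import HarnessLib.Audit.Tags

/-!
# Route `SchneiderFreeAdditiveX3` (K1 door), crux `PotMultBranchIMC` (stmt-BirchSwinnertonDyer-19176):
# the (M) research input RESTRICTED TO THE CRUX'S CLASS — `PotMultRead.KYCHMOrientedX3`

Cell `bsd-schneider-ideate` (HOME `run/shared/lean/pub/bsd-schneider-ideate/`), seat `door-c2` gen 10.
PARTITION: board row B6 ∩ X3 ∩ sst-twist, `r = 1`, (M) half (4 541 of 7 101 pairs) of `Rank1Residual.partition`;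
types-the-object-of the ONE research stub of the (M) line «rebased-M» in the scope the crux actually has; closes
nothing (BSD is not advanced; the crux stays OPEN). Theses-free.

WHY. `PotMultRead.KYCHMOriented` (door-c2 gen 9, p496004) quantifies over EVERY globally minimal partner `V`
multiplicative at `p` and every presentation `W = C₂ • ((D • V) ⊗ χ_{p*})` of analytic rank one on the N10 locus —
i.e. over the WHOLE potentially multiplicative additive cell, residually REDUCIBLE (`X3`) AND IRREDUCIBLE (`X4`)
curves alike (`Additive.N10.Locus W p = p ≠ 2 ∧ Addv W p ∧ (PotMult W p ∨ TypeGOrd W p)` carries no image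
condition). The crux `PotMultBranchIMC` it serves is stated on `ClassX3 W p = Red W p ∧ Addv W p` only. So the
registered research stub `stub_KYCH_M : KYCHMOriented` asserts MORE than the crux needs: its `X4 ∩ (M)` part (the
twisted-socket inequality for an IRREDUCIBLE multiplicative partner — the scope of Castella 2018 + erratum / the
refereed irreducible anticyclotomic literature, barrier entry `ReducibleAnticyclotomicAtBadP` list (B)) is a
DIFFERENT literature situation from its `X3 ∩ (M)` part (the scope wall itself). `KYCHMOrientedX3` inserts the
single binder `Red W p` — exactly the crux's own hypothesis — so that (door-c2 gen 10,
`…PotMultBranchIMCTight.lean`) the stub becomes EQUIVALENT to the crux modulo the route's named facts: the (M) line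
is then lossless, and what a future theorem must supply is precisely the crux moved to the partner's side. The change
is a WEAKENING of the stub (`KYCHMOriented → KYCHMOrientedX3`, immediate by dropping a hypothesis; not stated as a
theorem so that no audit reads a conjecture-to-conjecture implication as a proof).

Statement only — one predicate WITH BODY (conjecture-tagged obligation node, nothing asserted).
References: Keller–Yin arXiv:2410.23241 §3.4–3.5, p. 15 (shape; preprint); Cai–Shu–Tian, ANT 8 (2014) Thm. 1.5;
Castella–Hsieh, Math. Ann. 370 (2018) Thm. 5.7 (shape of the value formula at `p ∤ N`); Gross, LMS LNS 153 (1991)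
§3 (orientations); barrier `Literature.Barriers.BirchSwinnertonDyer.ReducibleAnticyclotomicAtBadP` (scope).
-/

noncomputable section

open scoped Classical

open WeierstrassCurve NumberField IsDedekindDomain Field
  Literature.NumberTheory.EllipticCurves
  Literature.NumberTheory.EllipticCurves.CaiShuTian2014
  Literature.NumberTheory.EllipticCurves.ModularForms
  Literature.NumberTheory.EllipticCurves.GreenbergSelmer
  Literature.NumberTheory.EllipticCurves.Rank1Residual
  Literature.NumberTheory.GaloisRepresentations
  Literature.NumberTheory.GaloisCohomology
  Summit.BirchSwinnertonDyer.Rank1Residual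
  Summit.BirchSwinnertonDyer.Rank1Residual.X11b
  Summit.BirchSwinnertonDyer.Rank1Residual.X11b.AcSelmer
  Summit.BirchSwinnertonDyer.Rank1Residual.X11b.Halves

-- D-0017 layout: summit = sub-problem, so `Summit.BirchSwinnertonDyer.BirchSwinnertonDyer.…` is the
-- mandated namespace (same option as the route's sockets files).
set_option linter.dupNamespace false
set_option autoImplicit false

namespace Summit.BirchSwinnertonDyer.BirchSwinnertonDyer.Theorems.SchneiderFree.PotMultRead

/-- **`KYCHMOrientedX3` — the ONE frame-level input of the (M) line, oriented AND restricted to the crux's class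
`X3` (`Red W p`).** `KYCHMOriented` with the single extra binder `Red (C₂ • ((D • V) ⊗ χ_{p*})) p` (the door
curve's residual representation is reducible — the crux `PotMultBranchIMC` is stated on `ClassX3 = Red ∧ Addv`
only; `Addv` and `SubM` already follow from `Mult V p` and the presentation). At every presented socket datum of a
door curve `W = C₂ • ((D • V) ⊗ χ_{p*})` with `Red W p` on the (M) cell and every anticyclotomic frame
`(κ, γ, 𝔭)` with `𝔭 ∣ p` of degree one, for every parametrisation datum `DtV` of the partner: a series
`L ∈ R₀⟦T⟧` and `u ∈ R₀` with (h3|M) `Ch_Λ(X_ac^∅(W_K))·R₀⟦T⟧ ⊆ (L)` and (h2|M) `L(0) = u·(log_ω Q / c_V)²`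
at the descended `χ_ε`-twisted conductor-`p` Heegner point `Q ∈ W(K)` of every ORIENTATION `β`
(`4 N_V ∣ β² − d_K`), `K[p]`-point `y` over `y_β(p)` and genus datum `θ`, `s`. RESEARCH — the branch main
conjecture ⊇ for the multiplicative EISENSTEIN partner on the `χ_ε`-branch and the conductor-`p` `p`-adic value
formula at `p ∥ N_V`, neither in print (barrier `ReducibleAnticyclotomicAtBadP`); EQUIVALENT to the crux modulo
the route's named facts (door-c2 gen 10). A predicate, conjecture-tagged, nothing asserted.
[cite: KellerYin2024b, §3.4–3.5 and p. 15 (arXiv:2410.23241) (shape; preprint; names the case open)]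
[cite: CastellaHsieh2018, Thm. 5.7 and Lemma 5.4 (shape of the value formula at p ∤ N)]
[cite: GrossLMS1991, §3 (Heegner points of conductor n and their orientations)] -/
@[conjecture]
def KYCHMOrientedX3 : Prop :=
  ∀ (p : ℕ) [Fact p.Prime] (V : WeierstrassCurve ℚ) [V.IsElliptic] [V.IsGloballyMinimal]
      [NeZero (V.conductorNorm ℤ)] (D C₂ : VariableChange ℚ) [(D • V).IsCharNeTwoNF]
      [(C₂ • (D • V).quadraticTwist ((-1 : ℚ) ^ (p / 2) * p)).IsElliptic]
      [(C₂ • (D • V).quadraticTwist ((-1 : ℚ) ^ (p / 2) * p)).IsGloballyMinimal]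
      (N : ℕ) [NeZero N] (K : Type) [Field K] [NumberField K]
      (Dt : ModularParametrizationData (C₂ • (D • V).quadraticTwist ((-1 : ℚ) ^ (p / 2) * p)) N)
      (H : HeegnerDatum N (NumberField.discr K)) (ι : K →+* ℂ)
      (P : ((C₂ • (D • V).quadraticTwist ((-1 : ℚ) ^ (p / 2) * p)).baseChange K).toAffine.Point),
      (C₂ • (D • V).quadraticTwist ((-1 : ℚ) ^ (p / 2) * p)).analyticRank = 1 →
      Additive.N10.Locus (C₂ • (D • V).quadraticTwist ((-1 : ℚ) ^ (p / 2) * p)) p →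
      (C₂ • (D • V).quadraticTwist ((-1 : ℚ) ^ (p / 2) * p)).conductorNorm ℤ = N →
      IsImaginaryQuadratic K → Odd (NumberField.discr K) → ¬ p ∣ Units.torsionOrder K →
      SatisfiesHeegnerHypothesis N K →
      ((C₂ • (D • V).quadraticTwist ((-1 : ℚ) ^ (p / 2) * p)).quadraticTwist
        (NumberField.discr K : ℚ)).entireLFunction 1 ≠ 0 →
      WeierstrassCurve.Affine.Point.map ι.toRatAlgHom P = heegnerPointComplex Dt H →
      ¬ IsOfFinAddOrder P → p ≠ 2 → Mult V p →
      Red (C₂ • (D • V).quadraticTwist ((-1 : ℚ) ^ (p / 2) * p)) p →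
      ∀ (κ : ZpExtension K p), κ.IsAnticyclotomic →
      ∀ (γ : Field.absoluteGaloisGroup K) [Fact (κ.IsTopGenerator γ)]
        (𝔭 : HeightOneSpectrum (𝓞 K)) (h𝔭 : ((p : ℕ) : 𝓞 K) ∈ 𝔭.asIdeal)
        (he : 𝔭.asIdeal.ramificationIdx (𝓞 ℚ) = 1) (hf : 𝔭.asIdeal.inertiaDeg (𝓞 ℚ) = 1),
      ∀ [NumberField (ringClassField K ι p)]
        (DtV : ModularParametrizationData V (V.conductorNorm ℤ)),
      ∃ (L : UnrSeries p) (u : unrIntegers p),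
        (XAc.charIdeal ((C₂ • (D • V).quadraticTwist ((-1 : ℚ) ^ (p / 2) * p)).baseChange K)
            p κ 𝔭 ∅ γ).map (PowerSeries.map (toUnr p)) ≤ Ideal.span {L} ∧
        ∀ (β : ℤ), 4 * (V.conductorNorm ℤ : ℤ) ∣ β ^ 2 - NumberField.discr K →
        ∀ (y : (V.baseChange (ringClassField K ι p : Type)).toAffine.Point),
          WeierstrassCurve.Affine.Point.map (ringClassField K ι p).subtype.toRatAlgHom y =
            heegnerPointComplexOfConductor DtV (NumberField.discr K) β p →
          ∀ (θ : ringClassField K ι p)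
            (hθ2 : θ ^ 2 = algebraMap ℚ (ringClassField K ι p) ((-1 : ℚ) ^ (p / 2) * p))
            (hθ : θ ≠ 0) (s : ringClassGal ι p → ℤˣ),
          (∀ σ : ringClassGal ι p, σ.1 θ = ((s σ : ℤ) : ringClassField K ι p) * θ) →
          ∀ Q : ((C₂ • (D • V).quadraticTwist ((-1 : ℚ) ^ (p / 2) * p)).baseChange K).toAffine.Point,
          Affine.Point.map (algebraMap K (ringClassField K ι p)).toRatAlgHom Q =
            VariableChange.pointEquivBaseChange ((D • V).quadraticTwist ((-1 : ℚ) ^ (p / 2) * p)) C₂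
              (ringClassField K ι p)
              ((VariableChange.pointEquiv (((D • V).quadraticTwist
                  ((-1 : ℚ) ^ (p / 2) * p)).baseChange (ringClassField K ι p : Type))
                  (untwistAt hθ)).symm
                ((Affine.Point.congrEquiv (untwistAt_smul_eq (D • V) hθ2 hθ)).symm
                  (VariableChange.pointEquivBaseChange V D (ringClassField K ι p)
                    (∑ τ : ringClassGal ι p,
                      (s τ : ℤ) • pointGalHom V (ringClassField K ι p : Type) τ.1 y)))) →
          L.HasValueAt 0 (((u : unrIntegers p) : ℂ_[p]) *
            (algebraMap ℚ_[p] ℂ_[p] (logOmega (C₂ • (D • V).quadraticTwist ((-1 : ℚ) ^ (p / 2) * p))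
              p (embAt K p 𝔭 h𝔭 he hf) Q / (DtV.c : ℚ_[p]))) ^ 2)

-- `KYCHMOriented → KYCHMOrientedX3` is immediate (ignore the extra binder `Red W p`); it is not stated as a
-- theorem here so that no audit reads a conjecture-to-conjecture implication as a proof of `KYCHMOrientedX3`.

end Summit.BirchSwinnertonDyer.BirchSwinnertonDyer.Theorems.SchneiderFree.PotMultRead

end
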